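import Mathlib
import Summits.NavierStokesRegularity.NavierStokesRegularity.Theorems.FilamentSkeletonRssKelvinGateClosingStatic
import Summits.NavierStokesRegularity.NavierStokesRegularity.Theorems.FilamentSkeletonRssDefectColumnGateContinuity

/-!
# Route `FilamentSkeletonRss` · crux `TransverseReductionRJ` (stmt-NavierStokesRegularity-21221) — line `kelvin_gate`,
# stub S3 `NonlinearClosingFrom` CLOSES once the gate's tightness clause (3) is quantified UNIFORMLY in the box parameter

Helper file (theorems only, `--supports stmt-NavierStokesRegularity-21221 --as helper`), in the vocabulary of
`FilamentSkeletonRssKelvinGateDefs`.  HONEST FRAMING: bookkeeping for a HYPOTHETICAL filament-type RSS blow-up route (MODEL rung,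
negative side, ASIDE item); nothing here bears on Navier–Stokes regularity; the registered stub `stub_nonlinearClosing :
NonlinearClosingFrom` is NOT proved as typed.

What is proved.  `Theorems.KelvinGate.nonlinearClosing_static` (landed) reduces S3 to ONE conjunct of `AlmostAdmissibleJ`: continuity on
the cube of the multipliers `p ↦ b⁰_p + 𝓑_p F_p` at the Picard fixed-point forcing `F_p = −r_p − D(𝓚_p F_p)[𝓚_p F_p]`.  That conjunct
does not follow from `GateSpec` as typed, because its tightness clause (3) (`∀ R L ε, ∃ L′ δ₀, …`) sits INSIDE `∀ p` — the radii `L′`,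
`δ₀` may degenerate as `q → p` (sizing note «S3-SIZING-typer-g30.md» on the item; leafhand fsrs-5: «S3 misstated — ContinuousOn B needs
p-uniform GateSpec(3)»).  The live successor line `defect_column_gate_1AG` (crux `TransverseReduction1AG`) RETYPED exactly this clause
(`DefectGateSpec1AG`: `∀ R L ε, 0 < ε → ∃ L′ δ₀, 0 < δ₀ ∧ ∀ β, …`) and its lead proved the continuity by PICARD TRUNCATION + a finite
regress of balls (`Theorems.DefectColumnGate.stub_defectContinuity1AG`, p646054).  Here:

* `GateSpec.continuousOn_multiplier_of_uniformTight` — the same argument on the CUBE `[0,1]^N` for the vector multipliers `𝓑_p F j`: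
  given `GateSpec`, the p-UNIFORM form of clause (3), a residual family `r_p` that is `Y ≤ ε` and locally continuous in `p`, the
  contraction regime `16 (C₂Γ^κ)² ε ≤ 1`, and ANY family of fixed points `G_p` with `Y(G_p) ≤ 2ε`, each `p ↦ 𝓑_p G_p j` is continuous
  on the cube (Picard iterates `Pₙ(p)` approximate `G_p` with `Y ≤ 2ε/2ⁿ` uniformly in `p`; each iterate is locally continuous in `p`
  by induction — gate clause (4) at fixed data, uniform (3) on the difference, local continuity of `r`; then a four-term split);
* `nonlinearClosingFrom_of_uniformTight` — **`NonlinearClosingFrom` with the uniform clause inserted as ONE extra hypothesis after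
  `GateSpec`** (all other binders VERBATIM, `k := max k₀ (⌈2κ⌉₊ + 1)`, `Γ₁` explicit as in `nonlinearClosing_static`): the per-parameter
  package `GateSpec.static_at` + the continuity above + `ContinuousOn b⁰` from `BaseSpec`.
So: if the planner retypes `GateSpec` (3) to the uniform form (one quantifier moved, as the 1AG line already did), stub S3 closes by name
with a three-line proof from this file; as typed it stays open (not refuted).
-/

set_option linter.dupNamespace false

noncomputable section

namespace Summit.NavierStokesRegularity.NavierStokesRegularity.Theorems.KelvinGate

open Set Function Filter
open Literature.Analysis.FluidPDE
open scoped InnerProductSpace Topology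
open Summit.NavierStokesRegularity.NavierStokesRegularity.Theorems.DefectColumnGate
  (picardIter picardIter_zero picardIter_succ picardIter_bound fixedPoint_sub_picardIter norm_clm_sub_apply_le)

/-- **Continuity of the multipliers on the cube from a p-UNIFORMLY tight gate** (port of
`Theorems.DefectColumnGate.stub_defectContinuity1AG` to the `kelvin_gate` vocabulary).  See the module docstring. [folklore] -/
theorem GateSpec.continuousOn_multiplier_of_uniformTight {N : ℕ} {Γ κ C₂ : ℝ} {α : (Fin N → ℝ) → ℝ}
    {D : (Fin N → ℝ) → Fin N → EuclideanSpace ℝ (Fin 3) → EuclideanSpace ℝ (Fin 3)}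
    {U0 : (Fin N → ℝ) → EuclideanSpace ℝ (Fin 3) → EuclideanSpace ℝ (Fin 3)}
    {𝓚 : (Fin N → ℝ) → (EuclideanSpace ℝ (Fin 3) → EuclideanSpace ℝ (Fin 3)) → EuclideanSpace ℝ (Fin 3) → EuclideanSpace ℝ (Fin 3)}
    {𝓠 : (Fin N → ℝ) → (EuclideanSpace ℝ (Fin 3) → EuclideanSpace ℝ (Fin 3)) → EuclideanSpace ℝ (Fin 3) → ℝ}
    {𝓑 : (Fin N → ℝ) → (EuclideanSpace ℝ (Fin 3) → EuclideanSpace ℝ (Fin 3)) → Fin N → ℝ}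
    (hgate : GateSpec N Γ κ C₂ α D U0 𝓚 𝓠 𝓑)
    (hUT : ∀ R L ε : ℝ, 0 < ε → ∃ L' δ₀ : ℝ, 0 < δ₀ ∧ ∀ p : Fin N → ℝ, (∀ i, p i ∈ Icc (0:ℝ) 1) →
      ∀ F : EuclideanSpace ℝ (Fin 3) → EuclideanSpace ℝ (Fin 3), YBound F R → (∀ y, ‖y‖ ≤ L' → ‖F y‖ ≤ δ₀) →
        (∀ y, ‖y‖ ≤ L → ‖𝓚 p F y‖ ≤ ε ∧ ‖fderiv ℝ (𝓚 p F) y‖ ≤ ε) ∧ ∀ j, |𝓑 p F j| ≤ ε)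
    {r : (Fin N → ℝ) → EuclideanSpace ℝ (Fin 3) → EuclideanSpace ℝ (Fin 3)} {ε : ℝ}
    (hres : ∀ p : Fin N → ℝ, (∀ i, p i ∈ Icc (0:ℝ) 1) → YBound (r p) ε)
    (hrc : ∀ p : Fin N → ℝ, (∀ i, p i ∈ Icc (0:ℝ) 1) → ∀ L t : ℝ, 0 < t → ∃ δ' : ℝ, 0 < δ' ∧
      ∀ q : Fin N → ℝ, (∀ i, q i ∈ Icc (0:ℝ) 1) → dist q p < δ' → ∀ y, ‖y‖ ≤ L → ‖r q y - r p y‖ ≤ t)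
    (h16 : 16 * (C₂ * Γ ^ κ) ^ 2 * ε ≤ 1)
    {G : (Fin N → ℝ) → EuclideanSpace ℝ (Fin 3) → EuclideanSpace ℝ (Fin 3)}
    (hG : ∀ p : Fin N → ℝ, (∀ i, p i ∈ Icc (0:ℝ) 1) →
      YBound (G p) (2 * ε) ∧ ∀ y, G p y = -r p y - fderiv ℝ (𝓚 p (G p)) y (𝓚 p (G p) y))
    (j : Fin N) :
    ContinuousOn (fun p => 𝓑 p (G p) j) {p : Fin N → ℝ | ∀ i, p i ∈ Icc (0:ℝ) 1} := by
  -- unpack the gate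
  have hK1 : ∀ p : Fin N → ℝ, (∀ i, p i ∈ Icc (0:ℝ) 1) → ∀ (F : EuclideanSpace ℝ (Fin 3) → EuclideanSpace ℝ (Fin 3)) (R : ℝ),
      YBound F R → XBound (𝓚 p F) (C₂ * Γ ^ κ * R) := fun p hp F R hF => ((hgate p hp).1 F R hF).1
  have hK2 : ∀ p : Fin N → ℝ, (∀ i, p i ∈ Icc (0:ℝ) 1) → ∀ (F F' : EuclideanSpace ℝ (Fin 3) → EuclideanSpace ℝ (Fin 3)) (s : ℝ),
      (∃ R, YBound F R) → (∃ R, YBound F' R) → 𝓚 p (fun y => F y + s • F' y) = fun y => 𝓚 p F y + s • 𝓚 p F' y :=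
    fun p hp F F' s hF hF' => ((hgate p hp).2.1 F F' s hF hF').1
  have hb2 : ∀ p : Fin N → ℝ, (∀ i, p i ∈ Icc (0:ℝ) 1) → ∀ (F F' : EuclideanSpace ℝ (Fin 3) → EuclideanSpace ℝ (Fin 3)) (s : ℝ),
      (∃ R, YBound F R) → (∃ R, YBound F' R) → 𝓑 p (fun y => F y + s • F' y) j = 𝓑 p F j + s * 𝓑 p F' j :=
    fun p hp F F' s hF hF' => congrFun ((hgate p hp).2.1 F F' s hF hF').2 j
  have hbB : ∀ p : Fin N → ℝ, (∀ i, p i ∈ Icc (0:ℝ) 1) → ∀ (F : EuclideanSpace ℝ (Fin 3) → EuclideanSpace ℝ (Fin 3)) (R : ℝ),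
      YBound F R → |𝓑 p F j| ≤ C₂ * Γ ^ κ * R := fun p hp F R hF => ((hgate p hp).1 F R hF).2.2.2.1 j
  have hgc : ∀ p : Fin N → ℝ, (∀ i, p i ∈ Icc (0:ℝ) 1) → ∀ (F : EuclideanSpace ℝ (Fin 3) → EuclideanSpace ℝ (Fin 3)) (R L e : ℝ),
      YBound F R → 0 < e → ∃ δ' : ℝ, 0 < δ' ∧ ∀ q : Fin N → ℝ, (∀ i, q i ∈ Icc (0:ℝ) 1) → dist q p < δ' →
        LocClose (𝓚 q F) (𝓚 p F) L e ∧ ∀ j, |𝓑 q F j - 𝓑 p F j| ≤ e := fun p hp => (hgate p hp).2.2.2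
  -- the empty cube is trivial; otherwise fix a base point to read off signs
  by_cases hne : ∃ p₀ : Fin N → ℝ, ∀ i, p₀ i ∈ Icc (0:ℝ) 1
  swap
  · intro p hp; exact absurd ⟨p, hp⟩ hne
  obtain ⟨p₀, hp₀⟩ := hne
  have hε0 : 0 ≤ ε := (hres p₀ hp₀).nonneg
  have hA0 : 0 ≤ C₂ * Γ ^ κ := by
    have h := (hK1 p₀ hp₀ (fun _ => 0) 1 (yBound_zero.mono zero_le_one)).nonneg
    linarith
  -- the Picard iterates at each parameter
  have hPb : ∀ p : Fin N → ℝ, (∀ i, p i ∈ Icc (0:ℝ) 1) → ∀ n, YBound (picardIter (𝓚 p) (r p) n) (2 * ε) :=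
    fun p hp n => picardIter_bound (hK1 p hp) (hK2 p hp) (hres p hp) h16 n
  have hdist : ∀ p : Fin N → ℝ, (∀ i, p i ∈ Icc (0:ℝ) 1) → ∀ n,
      YBound (fun y => G p y - picardIter (𝓚 p) (r p) n y) (2 * ε / 2 ^ n) :=
    fun p hp n => fixedPoint_sub_picardIter (hK1 p hp) (hK2 p hp) (hres p hp) h16 (hG p hp).1 (hG p hp).2 n
  -- `𝓑_p F − 𝓑_p F′ = 𝓑_p (F − F′)`
  have hbsub : ∀ p : Fin N → ℝ, (∀ i, p i ∈ Icc (0:ℝ) 1) → ∀ (F F' : EuclideanSpace ℝ (Fin 3) → EuclideanSpace ℝ (Fin 3)) (R R' : ℝ),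
      YBound F R → YBound F' R' → 𝓑 p F j - 𝓑 p F' j = 𝓑 p (fun y => F y - F' y) j := by
    intro p hp F F' R R' hF hF'
    have hd : YBound (fun y => F y - F' y) (R + R') := hF.sub hF'
    have e : (fun y => F' y + (1:ℝ) • (fun z => F z - F' z) y) = F := by funext y; simp
    have h := hb2 p hp F' (fun z => F z - F' z) 1 ⟨R', hF'⟩ ⟨R + R', hd⟩
    rw [e] at h
    rw [h]; ring
  -- LOCAL CONTINUITY OF THE ITERATES in `p` (finite regress of balls)
  have hloc : ∀ n : ℕ, ∀ p : Fin N → ℝ, (∀ i, p i ∈ Icc (0:ℝ) 1) → ∀ L t : ℝ, 0 < t → ∃ δ > 0,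
      ∀ q : Fin N → ℝ, (∀ i, q i ∈ Icc (0:ℝ) 1) → dist q p < δ →
      ∀ y, ‖y‖ ≤ L → ‖picardIter (𝓚 q) (r q) n y - picardIter (𝓚 p) (r p) n y‖ ≤ t := by
    intro n
    induction n with
    | zero =>
      intro p hp L t ht
      refine ⟨1, one_pos, fun q _ _ y _ => ?_⟩
      simp only [picardIter_zero, sub_self, norm_zero]
      exact ht.le
    | succ n ih =>
      intro p hp L t ht
      have ha0 : 0 ≤ C₂ * Γ ^ κ * (2 * ε) := by positivity
      obtain ⟨a, ha, ha0'⟩ : ∃ a : ℝ, a = C₂ * Γ ^ κ * (2 * ε) ∧ 0 ≤ a := ⟨_, rfl, ha0⟩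
      have he₄0 : 0 < t / (3 * (2 * a + 1)) := by positivity
      have hFY : YBound (picardIter (𝓚 p) (r p) n) (2 * ε) := hPb p hp n
      -- gate clause (4) at the datum `Pₙ(p)`, target `e₄` on the ball `L`
      obtain ⟨δ₄, hδ₄, h4⟩ := hgc p hp (picardIter (𝓚 p) (r p) n) _ L (t / (3 * (2 * a + 1))) hFY he₄0
      -- UNIFORM tightness (3) for differences (`Y ≤ 4ε`), target `e₄` on the ball `L`
      obtain ⟨L', δ₀, hδ₀, h3⟩ := hUT (2 * ε + 2 * ε) L (t / (3 * (2 * a + 1))) he₄0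
      -- induction hypothesis on the larger ball
      obtain ⟨δn, hδn, hn⟩ := ih p hp L' δ₀ hδ₀
      -- local continuity of the residual
      obtain ⟨δr, hδr, hrr⟩ := hrc p hp L (t / 3) (by positivity)
      refine ⟨min δn (min δ₄ δr), lt_min hδn (lt_min hδ₄ hδr), fun q hq hd y hy => ?_⟩
      have hd1 : dist q p < δn := lt_of_lt_of_le hd (min_le_left _ _)
      have hd4 : dist q p < δ₄ := lt_of_lt_of_le hd ((min_le_right _ _).trans (min_le_left _ _))
      have hdr : dist q p < δr := lt_of_lt_of_le hd ((min_le_right _ _).trans (min_le_right _ _))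
      have hF'Y : YBound (picardIter (𝓚 q) (r q) n) (2 * ε) := hPb q hq n
      have hdY : YBound (fun z => picardIter (𝓚 q) (r q) n z - picardIter (𝓚 p) (r p) n z) (2 * ε + 2 * ε) := hF'Y.sub hFY
      have hdsmall : ∀ z, ‖z‖ ≤ L' → ‖picardIter (𝓚 q) (r q) n z - picardIter (𝓚 p) (r p) n z‖ ≤ δ₀ :=
        fun z hz => hn q hq hd1 z hz
      obtain ⟨h3K, -⟩ := h3 q hq _ hdY hdsmall
      obtain ⟨h4K, -⟩ := h4 q hq hd4
      have hrq : ‖r q y - r p y‖ ≤ t / 3 := hrr q hq hdr y hy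
      -- `𝓚_q Pₙ(q) = 𝓚_q Pₙ(p) + 𝓚_q d`
      have hKsplit : 𝓚 q (picardIter (𝓚 q) (r q) n) = fun z => 𝓚 q (picardIter (𝓚 p) (r p) n) z +
          𝓚 q (fun z => picardIter (𝓚 q) (r q) n z - picardIter (𝓚 p) (r p) n z) z := by
        have e : (fun z => picardIter (𝓚 p) (r p) n z +
            (1:ℝ) • (fun z => picardIter (𝓚 q) (r q) n z - picardIter (𝓚 p) (r p) n z) z) = picardIter (𝓚 q) (r q) n := by
          funext z; simp
        have h := hK2 q hq (picardIter (𝓚 p) (r p) n) (fun z => picardIter (𝓚 q) (r q) n z - picardIter (𝓚 p) (r p) n z) 1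
          ⟨_, hFY⟩ ⟨_, hdY⟩
        rw [e] at h
        rw [h]; funext z; simp
      -- X-bounds and pointwise sizes
      have hXF : XBound (𝓚 q (picardIter (𝓚 p) (r p) n)) a := by rw [ha]; exact hK1 q hq _ _ hFY
      have hXFp : XBound (𝓚 p (picardIter (𝓚 p) (r p) n)) a := by rw [ha]; exact hK1 p hp _ _ hFY
      have hXF' : XBound (𝓚 q (picardIter (𝓚 q) (r q) n)) a := by rw [ha]; exact hK1 q hq _ _ hF'Y
      have hXd : XBound (𝓚 q (fun z => picardIter (𝓚 q) (r q) n z - picardIter (𝓚 p) (r p) n z)) (C₂ * Γ ^ κ * (2 * ε + 2 * ε)) :=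
        hK1 q hq _ _ hdY
      obtain ⟨hv1, hD1⟩ := hXF.norm_le' y
      obtain ⟨hv2, hD2⟩ := hXFp.norm_le' y
      obtain ⟨hv3, hD3⟩ := hXF'.norm_le' y
      obtain ⟨hKd, hDKd⟩ := h3K y hy
      obtain ⟨h4v, h4D⟩ := h4K y hy
      -- the `(n+1)`-st difference
      rw [picardIter_succ, picardIter_succ]
      simp only
      have hDsplit : fderiv ℝ (𝓚 q (picardIter (𝓚 q) (r q) n)) y = fderiv ℝ (𝓚 q (picardIter (𝓚 p) (r p) n)) y +
          fderiv ℝ (𝓚 q (fun z => picardIter (𝓚 q) (r q) n z - picardIter (𝓚 p) (r p) n z)) y := by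
        rw [hKsplit]
        exact fderiv_fun_add (hXF.1.differentiable (by norm_num) y) (hXd.1.differentiable (by norm_num) y)
      have hvsplit : 𝓚 q (picardIter (𝓚 q) (r q) n) y = 𝓚 q (picardIter (𝓚 p) (r p) n) y +
          𝓚 q (fun z => picardIter (𝓚 q) (r q) n z - picardIter (𝓚 p) (r p) n z) y := by rw [hKsplit]
      set K'F := 𝓚 q (picardIter (𝓚 p) (r p) n) with hK'F
      set KF := 𝓚 p (picardIter (𝓚 p) (r p) n) with hKF
      set K'F' := 𝓚 q (picardIter (𝓚 q) (r q) n) with hK'F'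
      set K'd := 𝓚 q (fun z => picardIter (𝓚 q) (r q) n z - picardIter (𝓚 p) (r p) n z) with hK'd
      have eT : fderiv ℝ K'F' y (K'F' y) - fderiv ℝ KF y (KF y) =
          fderiv ℝ K'd y (K'F' y) + fderiv ℝ K'F y (K'd y) + (fderiv ℝ K'F y (K'F y) - fderiv ℝ KF y (K'F y)) +
            fderiv ℝ KF y (K'F y - KF y) := by
        rw [hDsplit, hvsplit]
        simp only [_root_.add_apply, map_add, map_sub]
        abel
      have hT1 : ‖fderiv ℝ K'd y (K'F' y)‖ ≤ t / (3 * (2 * a + 1)) * a :=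
        (ContinuousLinearMap.le_opNorm _ _).trans (mul_le_mul hDKd hv3 (norm_nonneg _) he₄0.le)
      have hT2 : ‖fderiv ℝ K'F y (K'd y)‖ ≤ a * (t / (3 * (2 * a + 1))) :=
        (ContinuousLinearMap.le_opNorm _ _).trans (mul_le_mul hD1 hKd (norm_nonneg _) ha0')
      have hT3 : ‖fderiv ℝ K'F y (K'F y) - fderiv ℝ KF y (K'F y)‖ ≤ t / (3 * (2 * a + 1)) * a :=
        (norm_clm_sub_apply_le _ _ _).trans (mul_le_mul h4D hv1 (norm_nonneg _) he₄0.le)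
      have hT4 : ‖fderiv ℝ KF y (K'F y - KF y)‖ ≤ a * (t / (3 * (2 * a + 1))) :=
        (ContinuousLinearMap.le_opNorm _ _).trans (mul_le_mul hD2 h4v (norm_nonneg _) ha0')
      have hsum : ‖fderiv ℝ K'F' y (K'F' y) - fderiv ℝ KF y (KF y)‖ ≤ 4 * a * (t / (3 * (2 * a + 1))) := by
        rw [eT]
        calc _ ≤ ‖fderiv ℝ K'd y (K'F' y) + fderiv ℝ K'F y (K'd y) + (fderiv ℝ K'F y (K'F y) - fderiv ℝ KF y (K'F y))‖ +
              ‖fderiv ℝ KF y (K'F y - KF y)‖ := norm_add_le _ _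
          _ ≤ (‖fderiv ℝ K'd y (K'F' y) + fderiv ℝ K'F y (K'd y)‖ + ‖fderiv ℝ K'F y (K'F y) - fderiv ℝ KF y (K'F y)‖) +
              ‖fderiv ℝ KF y (K'F y - KF y)‖ := by gcongr; exact norm_add_le _ _
          _ ≤ ((‖fderiv ℝ K'd y (K'F' y)‖ + ‖fderiv ℝ K'F y (K'd y)‖) + ‖fderiv ℝ K'F y (K'F y) - fderiv ℝ KF y (K'F y)‖) +
              ‖fderiv ℝ KF y (K'F y - KF y)‖ := by gcongr; exact norm_add_le _ _
          _ ≤ ((t / (3 * (2 * a + 1)) * a + a * (t / (3 * (2 * a + 1)))) + t / (3 * (2 * a + 1)) * a) + a * (t / (3 * (2 * a + 1))) := by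
              gcongr
          _ = 4 * a * (t / (3 * (2 * a + 1))) := by ring
      have hfrac : 4 * a * (t / (3 * (2 * a + 1))) ≤ 2 * t / 3 := by
        have hpos : 0 < 3 * (2 * a + 1) := by positivity
        rw [show 4 * a * (t / (3 * (2 * a + 1))) = (4 * a * t) / (3 * (2 * a + 1)) by ring, div_le_iff₀ hpos]
        nlinarith [ha0', ht.le]
      calc ‖-r q y - fderiv ℝ K'F' y (K'F' y) - (-r p y - fderiv ℝ KF y (KF y))‖
          = ‖-(r q y - r p y) - (fderiv ℝ K'F' y (K'F' y) - fderiv ℝ KF y (KF y))‖ := by congr 1; abel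
        _ ≤ ‖-(r q y - r p y)‖ + ‖fderiv ℝ K'F' y (K'F' y) - fderiv ℝ KF y (KF y)‖ := norm_sub_le _ _
        _ ≤ t / 3 + 2 * t / 3 := by rw [norm_neg]; exact add_le_add hrq (hsum.trans hfrac)
        _ = t := by ring
  -- CONTINUITY of `p ↦ 𝓑_p G_p j` on the cube
  rw [Metric.continuousOn_iff]
  intro p hpW t ht
  have hp : ∀ i, p i ∈ Icc (0:ℝ) 1 := hpW
  -- choose the truncation `n`: `C₂Γ^κ · (2ε/2ⁿ) ≤ t/8`
  obtain ⟨n, hn⟩ : ∃ n : ℕ, 16 * (C₂ * Γ ^ κ) * ε / t < (2:ℝ) ^ n := pow_unbounded_of_one_lt _ one_lt_two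
  have hpow : (0:ℝ) < 2 ^ n := by positivity
  have htail : C₂ * Γ ^ κ * (2 * ε / 2 ^ n) ≤ t / 8 := by
    have h1 : 16 * (C₂ * Γ ^ κ) * ε < t * 2 ^ n := by
      have := (div_lt_iff₀ ht).mp hn; linarith
    rw [show C₂ * Γ ^ κ * (2 * ε / 2 ^ n) = (2 * (C₂ * Γ ^ κ) * ε) / 2 ^ n by ring, div_le_iff₀ hpow]
    linarith
  -- uniform (3) for the `𝓑`-part of the difference of the `n`-th iterates, target `t/8`
  obtain ⟨L', δ₀, hδ₀, h3⟩ := hUT (2 * ε + 2 * ε) 0 (t / 8) (by positivity)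
  obtain ⟨δn, hδn, hnloc⟩ := hloc n p hp L' δ₀ hδ₀
  -- (4) at the datum `Pₙ(p)`, target `t/8`
  obtain ⟨δ₄, hδ₄, h4⟩ := hgc p hp (picardIter (𝓚 p) (r p) n) _ 0 (t / 8) (hPb p hp n) (by positivity)
  refine ⟨min δn δ₄, lt_min hδn hδ₄, fun q hqW hd => ?_⟩
  have hq : ∀ i, q i ∈ Icc (0:ℝ) 1 := hqW
  rw [Real.dist_eq]
  have hd1 : dist q p < δn := lt_of_lt_of_le hd (min_le_left _ _)
  have hd4 : dist q p < δ₄ := lt_of_lt_of_le hd (min_le_right _ _)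
  -- the four pieces
  have p1 : |𝓑 q (G q) j - 𝓑 q (picardIter (𝓚 q) (r q) n) j| ≤ t / 8 := by
    rw [hbsub q hq _ _ _ _ (hG q hq).1 (hPb q hq n)]
    exact (hbB q hq _ _ (hdist q hq n)).trans htail
  have p4 : |𝓑 p (picardIter (𝓚 p) (r p) n) j - 𝓑 p (G p) j| ≤ t / 8 := by
    rw [abs_sub_comm, hbsub p hp _ _ _ _ (hG p hp).1 (hPb p hp n)]
    exact (hbB p hp _ _ (hdist p hp n)).trans htail
  have p2 : |𝓑 q (picardIter (𝓚 q) (r q) n) j - 𝓑 q (picardIter (𝓚 p) (r p) n) j| ≤ t / 8 := by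
    rw [hbsub q hq _ _ _ _ (hPb q hq n) (hPb p hp n)]
    exact (h3 q hq _ ((hPb q hq n).sub (hPb p hp n)) (fun z hz => hnloc q hq hd1 z hz)).2 j
  have p3 : |𝓑 q (picardIter (𝓚 p) (r p) n) j - 𝓑 p (picardIter (𝓚 p) (r p) n) j| ≤ t / 8 := (h4 q hq hd4).2 j
  calc |𝓑 q (G q) j - 𝓑 p (G p) j|
      = |(𝓑 q (G q) j - 𝓑 q (picardIter (𝓚 q) (r q) n) j) +
          (𝓑 q (picardIter (𝓚 q) (r q) n) j - 𝓑 q (picardIter (𝓚 p) (r p) n) j) +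
          (𝓑 q (picardIter (𝓚 p) (r p) n) j - 𝓑 p (picardIter (𝓚 p) (r p) n) j) +
          (𝓑 p (picardIter (𝓚 p) (r p) n) j - 𝓑 p (G p) j)| := by congr 1; ring
    _ ≤ |𝓑 q (G q) j - 𝓑 q (picardIter (𝓚 q) (r q) n) j| +
          |𝓑 q (picardIter (𝓚 q) (r q) n) j - 𝓑 q (picardIter (𝓚 p) (r p) n) j| +
          |𝓑 q (picardIter (𝓚 p) (r p) n) j - 𝓑 p (picardIter (𝓚 p) (r p) n) j| +
          |𝓑 p (picardIter (𝓚 p) (r p) n) j - 𝓑 p (G p) j| := by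
        refine (abs_add_le _ _).trans ?_
        refine add_le_add ((abs_add_le _ _).trans (add_le_add (abs_add_le _ _) le_rfl)) le_rfl
    _ ≤ t / 8 + t / 8 + t / 8 + t / 8 := by gcongr
    _ < t := by linarith

/-- **Stub S3 `NonlinearClosingFrom` GIVEN the p-uniform tightness clause** — the registered statement with ONE extra hypothesis
inserted after `GateSpec` (all other binders verbatim; `k := max k₀ (⌈2κ⌉₊ + 1)`, `Γ₁` explicit).  Proof: per-parameter package
`GateSpec.static_at` at the Picard fixed point + `GateSpec.continuousOn_multiplier_of_uniformTight` + `ContinuousOn b⁰`. [folklore] -/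
theorem nonlinearClosingFrom_of_uniformTight :
    ∀ (N : ℕ) (δ ρ K Λ a b cnd η Rw Rb cg θ₀ : ℝ), 0 < N → 0 < δ → 0 < ρ → 0 ≤ a → 0 < η → 0 < Rw → 0 < Rb → 0 < cg → 0 < θ₀ →
    ∀ Cs κ C₂ : ℝ, ∀ k₀ : ℕ, ∃ k : ℕ, k₀ ≤ k ∧ 1 ≤ k ∧ ∀ Cr : ℝ, ∃ Γ₁ : ℝ, ∀ Γ : ℝ, Γ₁ ≤ Γ →
      ∀ (γ : (Fin N → ℝ) → Fin N → ℝ) (α : (Fin N → ℝ) → ℝ) (X : (Fin N → ℝ) → Fin N → ℝ → EuclideanSpace ℝ (Fin 3))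
        (w : (Fin N → ℝ) → Fin N → ℝ → ℝ) (c : (Fin N → ℝ) → Fin N → ℝ) (m : (Fin N → ℝ) → Fin N → EuclideanSpace ℝ (Fin 3))
        (n : (Fin N → ℝ) → Fin N → EuclideanSpace ℝ (Fin 3))
        (u : (Fin N → ℝ) → (Fin N → ℝ → EuclideanSpace ℝ (Fin 3)) → EuclideanSpace ℝ (Fin 3) → EuclideanSpace ℝ (Fin 3))
        (v : (Fin N → ℝ) → EuclideanSpace ℝ (Fin 3) → EuclideanSpace ℝ (Fin 3))
        (A : (Fin N → ℝ) → Fin N → (EuclideanSpace ℝ (Fin 3) →L[ℝ] EuclideanSpace ℝ (Fin 3)))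
        (T : (Fin N → ℝ) → (Fin N → ℝ → EuclideanSpace ℝ (Fin 3)) → Fin N → ℝ → EuclideanSpace ℝ (Fin 3))
        (D : (Fin N → ℝ) → Fin N → EuclideanSpace ℝ (Fin 3) → EuclideanSpace ℝ (Fin 3)),
      DefU N Γ γ u → DefV N α X u v → DefA N X c v A → DefT N α u T → DefD N X c D →
      BoxClausesJ N Γ δ ρ K Λ a b cnd Rw Rb cg θ₀ γ α X w c m n v A T →
      ∀ (U0 : (Fin N → ℝ) → EuclideanSpace ℝ (Fin 3) → EuclideanSpace ℝ (Fin 3)) (P0 : (Fin N → ℝ) → EuclideanSpace ℝ (Fin 3) → ℝ)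
        (b0 : (Fin N → ℝ) → Fin N → ℝ), BaseSpec N Γ ρ η Rw k Cs Cr α X u D U0 P0 b0 →
      ∀ (𝓚 : (Fin N → ℝ) → (EuclideanSpace ℝ (Fin 3) → EuclideanSpace ℝ (Fin 3)) → EuclideanSpace ℝ (Fin 3) → EuclideanSpace ℝ (Fin 3))
        (𝓠 : (Fin N → ℝ) → (EuclideanSpace ℝ (Fin 3) → EuclideanSpace ℝ (Fin 3)) → EuclideanSpace ℝ (Fin 3) → ℝ)
        (𝓑 : (Fin N → ℝ) → (EuclideanSpace ℝ (Fin 3) → EuclideanSpace ℝ (Fin 3)) → Fin N → ℝ),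
        GateSpec N Γ κ C₂ α D U0 𝓚 𝓠 𝓑 →
      (∀ R L ε : ℝ, 0 < ε → ∃ L' δ₀ : ℝ, 0 < δ₀ ∧ ∀ p : Fin N → ℝ, (∀ i, p i ∈ Icc (0:ℝ) 1) →
        ∀ F : EuclideanSpace ℝ (Fin 3) → EuclideanSpace ℝ (Fin 3), YBound F R → (∀ y, ‖y‖ ≤ L' → ‖F y‖ ≤ δ₀) →
          (∀ y, ‖y‖ ≤ L → ‖𝓚 p F y‖ ≤ ε ∧ ‖fderiv ℝ (𝓚 p F) y‖ ≤ ε) ∧ ∀ j, |𝓑 p F j| ≤ ε) →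
      ∃ (C₀ M : ℝ) (U : (Fin N → ℝ) → EuclideanSpace ℝ (Fin 3) → EuclideanSpace ℝ (Fin 3))
        (P : (Fin N → ℝ) → EuclideanSpace ℝ (Fin 3) → ℝ) (B : (Fin N → ℝ) → Fin N → ℝ),
        AlmostAdmissibleJ N Γ ρ η Rw α X u D C₀ M U P B := by
  intro N δ ρ K Λ a b cnd η Rw Rb cg θ₀ hN hδ hρ ha hη hRw hRb hcg hθ₀ Cs κ C₂ k₀
  refine ⟨max k₀ (⌈2 * κ⌉₊ + 1), le_max_left _ _, (Nat.le_add_left 1 _).trans (le_max_right _ _), fun Cr => ?_⟩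
  set k : ℕ := max k₀ (⌈2 * κ⌉₊ + 1) with hkdef
  have hk1 : 1 ≤ k := (Nat.le_add_left 1 _).trans (le_max_right _ _)
  have hk : 2 * κ + 1 ≤ (k : ℝ) := by
    have h := Nat.le_ceil (2 * κ)
    have h2 : ((⌈2 * κ⌉₊ + 1 : ℕ) : ℝ) ≤ (k : ℝ) := by exact_mod_cast le_max_right k₀ (⌈2 * κ⌉₊ + 1)
    push_cast at h2
    linarith
  refine ⟨max 1 (16 * C₂ ^ 2 * |Cr| + 4 * |C₂| * |Cr| + 4 * |C₂| * |Cr| / η + 1), fun Γ hΓ => ?_⟩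
  intro γ α X w c m n u v A T D hu hv hA hT hD hbox U0 P0 b0 hbase 𝓚 𝓠 𝓑 hgate hUT
  have hΓ1 : 1 ≤ Γ := le_trans (le_max_left _ _) hΓ
  have hΓ0 : 0 < Γ := by linarith
  have hΓ2 : 16 * C₂ ^ 2 * |Cr| + 4 * |C₂| * |Cr| + 4 * |C₂| * |Cr| / η + 1 ≤ Γ := le_trans (le_max_right _ _) hΓ
  obtain ⟨ht1, ht2⟩ := rpow_gate_threshold hΓ1 hk hk1
  -- the residual constant is non-negative (the cube is inhabited)
  have hp0 : ∀ i : Fin N, (fun _ : Fin N => (0:ℝ)) i ∈ Icc (0:ℝ) 1 := fun _ => ⟨le_rfl, zero_le_one⟩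
  set ε : ℝ := Cr * Γ ^ (-(k:ℝ)) with hεdef
  have hε0 : 0 ≤ ε := (hbase.2 _ hp0).2.2.2.2.2.2.2.2.1.nonneg
  have hpow : 0 < Γ ^ (-(k:ℝ)) := Real.rpow_pos_of_pos hΓ0 _
  have hCr : 0 ≤ Cr := by
    by_contra hlt
    push Not at hlt
    have : Cr * Γ ^ (-(k:ℝ)) < 0 := mul_neg_of_neg_of_pos hlt hpow
    linarith
  have hCr' : Cr = |Cr| := (abs_of_nonneg hCr).symm
  have hκ0 : 0 ≤ Γ ^ κ := Real.rpow_nonneg hΓ0.le κ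
  have h41 : 0 ≤ 4 * |C₂| * |Cr| / η := by positivity
  have h42 : 0 ≤ 4 * |C₂| * |Cr| := by positivity
  have h43 : 0 ≤ 16 * C₂ ^ 2 * |Cr| := by positivity
  -- smallness 1: `16 (C₂Γ^κ)² ε ≤ 1`
  have hA' : 16 * (C₂ * Γ ^ κ) ^ 2 * ε ≤ 1 := by
    have e : 16 * (C₂ * Γ ^ κ) ^ 2 * ε = 16 * C₂ ^ 2 * Cr * ((Γ ^ κ) ^ 2 * Γ ^ (-(k:ℝ))) := by rw [hεdef]; ring
    rw [e]
    have h1 : 16 * C₂ ^ 2 * Cr * ((Γ ^ κ) ^ 2 * Γ ^ (-(k:ℝ))) ≤ 16 * C₂ ^ 2 * Cr * Γ⁻¹ :=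
      mul_le_mul_of_nonneg_left ht1 (by positivity)
    have h2 : 16 * C₂ ^ 2 * Cr * Γ⁻¹ ≤ 1 := by
      rw [← div_eq_mul_inv, div_le_one hΓ0, hCr']
      linarith
    exact h1.trans h2
  -- smallness 2 and 3: `R_W ≤ 1/2`, `R_W ≤ η√Γ/2`
  have hRW : C₂ * Γ ^ κ * (2 * ε) ≤ 2 * |C₂| * |Cr| * Γ⁻¹ := by
    have e : C₂ * Γ ^ κ * (2 * ε) = 2 * (C₂ * Cr) * (Γ ^ κ * Γ ^ (-(k:ℝ))) := by rw [hεdef]; ring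
    rw [e]
    have h1 : 2 * (C₂ * Cr) * (Γ ^ κ * Γ ^ (-(k:ℝ))) ≤ 2 * (|C₂| * |Cr|) * (Γ ^ κ * Γ ^ (-(k:ℝ))) := by
      refine mul_le_mul_of_nonneg_right (mul_le_mul_of_nonneg_left ?_ (by norm_num)) (mul_nonneg hκ0 hpow.le)
      rw [← abs_mul]; exact le_abs_self _
    have h2 : 2 * (|C₂| * |Cr|) * (Γ ^ κ * Γ ^ (-(k:ℝ))) ≤ 2 * (|C₂| * |Cr|) * Γ⁻¹ :=
      mul_le_mul_of_nonneg_left ht2 (by positivity)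
    linarith
  have hRW1 : C₂ * Γ ^ κ * (2 * ε) ≤ 1 / 2 := by
    refine hRW.trans ?_
    rw [← div_eq_mul_inv, div_le_iff₀ hΓ0]
    linarith
  have hRW2 : C₂ * Γ ^ κ * (2 * ε) ≤ η * √Γ / 2 := by
    refine hRW.trans ?_
    have hs : 1 ≤ √Γ := by rw [← Real.sqrt_one]; exact Real.sqrt_le_sqrt hΓ1
    have h1 : 2 * |C₂| * |Cr| * Γ⁻¹ ≤ η / 2 := by
      rw [← div_eq_mul_inv, div_le_iff₀ hΓ0]
      have h3 : 4 * |C₂| * |Cr| / η ≤ Γ := by linarith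
      have h4 := (div_le_iff₀ hη).mp h3
      linarith
    have h2 : η / 2 ≤ η * √Γ / 2 := by
      have := mul_le_mul_of_nonneg_left hs hη.le
      linarith
    exact h1.trans h2
  -- per-parameter package at the Picard fixed point
  have key : ∀ p : Fin N → ℝ, (∀ i, p i ∈ Icc (0:ℝ) 1) → ∃ F : EuclideanSpace ℝ (Fin 3) → EuclideanSpace ℝ (Fin 3),
      YBound F (2 * ε) ∧
      (∀ y, F y = -(baseRes α D U0 P0 b0 p y) - fderiv ℝ (𝓚 p F) y (𝓚 p F y)) ∧
      (fun z => U0 p z + 𝓚 p F z) ≠ 0 ∧ ContDiff ℝ 2 (fun z => U0 p z + 𝓚 p F z) ∧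
      ContDiff ℝ 1 (fun z => P0 p z + 𝓠 p F z) ∧ VectorCalculus.IsDivFree (fun z => U0 p z + 𝓚 p F z) ∧
      (∀ y, α p • (cross (EuclideanSpace.single 2 1) ((fun z => U0 p z + 𝓚 p F z) y) -
            fderiv ℝ (fun z => U0 p z + 𝓚 p F z) y (cross (EuclideanSpace.single 2 1) y)) +
          (1/2:ℝ) • (fun z => U0 p z + 𝓚 p F z) y + (1/2:ℝ) • fderiv ℝ (fun z => U0 p z + 𝓚 p F z) y y -
          (Laplacian.laplacian (fun z => U0 p z + 𝓚 p F z)) y +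
          fderiv ℝ (fun z => U0 p z + 𝓚 p F z) y ((fun z => U0 p z + 𝓚 p F z) y) +
          gradient (fun z => P0 p z + 𝓠 p F z) y = ∑ j, (b0 p j + 𝓑 p F j) • D p j y) ∧
      (∀ y, ‖U0 p y + 𝓚 p F y‖ ≤ (Cs * Γ ^ 4 + C₂ * Γ ^ κ * (2 * ε)) / (1 + ‖y‖)) ∧
      (∀ y, |P0 p y + 𝓠 p F y| ≤ Cs * Γ ^ 4 + C₂ * Γ ^ κ * (2 * ε)) ∧
      (∀ y, ‖y‖ ≤ Rw * √Γ → (∀ j τ, ρ * √Γ / 4 ≤ ‖y - X p j τ‖) →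
          ‖(U0 p y + 𝓚 p F y) - u p (X p) y‖ ≤ η * √Γ) ∧
      (∀ j, |𝓑 p F j| ≤ C₂ * Γ ^ κ * (2 * ε)) := by
    intro p hp
    obtain ⟨hU0s, hP0s, hdiv0, hX0, hP0b, -, hnd, hwin0, hres, -⟩ := hbase.2 p hp
    exact hgate.static_at hp (contDiff_infty.mp hU0s 2) (contDiff_infty.mp hP0s 1)
      hdiv0 hX0 hP0b hnd hwin0 hres hA' hRW1 hRW2
  choose! F hF using key
  -- continuity of the multipliers on the cube (the conjunct `GateSpec` (3) as typed does not give)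
  have hcontB : ContinuousOn (fun p j => b0 p j + 𝓑 p (F p) j) {p : Fin N → ℝ | ∀ i, p i ∈ Icc (0:ℝ) 1} := by
    refine continuousOn_pi.2 fun j => ((continuousOn_pi.1 hbase.1) j).add ?_
    refine hgate.continuousOn_multiplier_of_uniformTight hUT (r := baseRes α D U0 P0 b0) (ε := ε)
      (fun p hp => (hbase.2 p hp).2.2.2.2.2.2.2.2.1) (fun p hp L t ht => ?_) hA'
      (fun p hp => ⟨(hF p hp).1, (hF p hp).2.1⟩) j
    obtain ⟨δ', hδ', h⟩ := (hbase.2 p hp).2.2.2.2.2.2.2.2.2 L t ht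
    exact ⟨δ', hδ', fun q hq hd y hy => (h q hq hd).2 y hy⟩
  refine ⟨Cs * Γ ^ 4 + C₂ * Γ ^ κ * (2 * ε), Cs * Γ ^ 4 + C₂ * Γ ^ κ * (2 * ε),
    fun p z => U0 p z + 𝓚 p (F p) z, fun p z => P0 p z + 𝓠 p (F p) z, fun p j => b0 p j + 𝓑 p (F p) j, hcontB, fun p hp => ?_⟩
  obtain ⟨-, -, hne, hC2, hC1, hdiv, heq, hdec, hPb, hwin, -⟩ := hF p hp
  exact ⟨hne, hC2, hC1, hdiv, heq, hdec, hPb, hwin⟩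

end Summit.NavierStokesRegularity.NavierStokesRegularity.Theorems.KelvinGate

end
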